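import Literature.Analysis.FluidPDE.TorusVorticityTensorTransport
import HarnessLib

/-!
# FunctionalMining — the velocity-gradient transport identity along classical solutions on `T^d`

Search for candidate a priori estimates; no regularity claim. Cell `pub-nsfunc`, prove seat
(gen 9). Infrastructure toward the K0 rows `ES.absS.q|T_LD|G1` (strain moments `∫|S|^q`, SIEVELD
§3.3), whose balance needs the evolution of the full velocity gradient `Vᵢⱼ = (∂ᵢu)ⱼ` — the
symmetric part carries the pressure Hessian, which drops from the antisymmetric part treated by the
tree (`IsClassicalNSSolutionOn.timeDerivWithin_torusVorticityTensor`, Majda–Bertozzi (1.31)). Along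
a classical solution of `∂ₜu + (u·∇)u = νΔu − ∇p + f`, `div u = 0` on `T^d × [a, b]`:

`∂ₜ(∂ᵢu)ⱼ = ν (∂ᵢΔu)ⱼ − ∂ᵢ∂ⱼp + (∂ᵢf)ⱼ − ∑ₖ (∂ᵢu)ₖ(∂ₖu)ⱼ − ∑ₖ uₖ ∂ₖ(∂ᵢu)ⱼ`

(one-sided time derivative within `[a, b]`; Majda–Bertozzi 2002, §1.4 (1.29):
`DV/Dt + V² = −P + νΔV`, "computing the `∂_{x_k}` derivative of the Navier–Stokes equation").
The proof is the tree's: `∂ₜ∂ᵢ = ∂ᵢ∂ₜ` (`Torus.timeDerivWithin_partialDeriv_comm`), differentiate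
the momentum equation, `∂ᵢ((u·∇)u)ⱼ = ∑ₖ uₖ∂ₖ∂ᵢuⱼ + ∑ₖ ∂ᵢuₖ∂ₖuⱼ` (`Torus.partialDeriv_convect_self`).

## Main statements

* `hasDerivWithinAt_partialDeriv_apply` — the slice `s ↦ (∂ᵢu(s))ⱼ(x)` is differentiable within
  `[a, b]` with derivative `(∂ᵢ ∂ₜu)ⱼ(x)`.
* `timeDerivWithin_partialDeriv_apply` — the transport identity above.
-/

noncomputable section

open MeasureTheory Finset Set
open scoped InnerProductSpace RealInnerProductSpace ContDiff

namespace Summit.NavierStokesRegularity.FunctionalMining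

open Literature.Analysis.FunctionSpaces Literature.Analysis.FluidPDE

namespace GradientTensor

variable {d : Type*} [Fintype d] [DecidableEq d]

omit [DecidableEq d] in
/-- Coordinates of one-sided time derivatives: `(∂ₜφ)ⱼ = ∂ₜ(φⱼ)` for jointly smooth `φ`. [folklore] -/
theorem timeDerivWithin_apply_coord {S : Set ℝ} {φ : ℝ → UnitAddTorus d → EuclideanSpace ℝ d}
    (hφ : Torus.IsSmoothSpaceTimeOn S φ) (hS : UniqueDiffOn ℝ S) {t : ℝ} (ht : t ∈ S)
    (x : UnitAddTorus d) (j : d) :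
    Torus.timeDerivWithin S (fun s y => φ s y j) t x = Torus.timeDerivWithin S φ t x j := by
  have h := hφ.hasDerivWithinAt_slice ht x
  have h2 : HasDerivWithinAt (fun τ => φ τ x j) (Torus.timeDerivWithin S φ t x j) S t :=
    (EuclideanSpace.proj j : EuclideanSpace ℝ d →L[ℝ] ℝ).hasFDerivAt.comp_hasDerivWithinAt t h
  exact h2.derivWithin (hS t ht)

/-- Coordinates of the torus gradient: `(∇θ)ⱼ = ∂ⱼθ` for `C¹` `θ`. [folklore] -/
theorem gradient_apply_eq_partialDeriv {θ : UnitAddTorus d → ℝ} (hθ : Torus.IsContDiff 1 θ)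
    (x : UnitAddTorus d) (j : d) : Torus.gradient θ x j = Torus.partialDeriv j θ x := by
  rw [Torus.gradient_eq_sum_partialDeriv hθ]
  simp [Finset.sum_apply, Pi.single_apply]

/-- **The slice `s ↦ (∂ᵢu(s))ⱼ(x)` is differentiable in time** along a classical solution, with
one-sided derivative `(∂ᵢA)ⱼ(x)`, `A = ∂ₜu` the one-sided time derivative of the velocity
(`∂ₜ∂ᵢ = ∂ᵢ∂ₜ`, tree `Torus.timeDerivWithin_partialDeriv_comm`). [folklore] -/
theorem hasDerivWithinAt_partialDeriv_apply
    {a b ν : ℝ} {f u : ℝ → UnitAddTorus d → EuclideanSpace ℝ d} {p : ℝ → UnitAddTorus d → ℝ}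
    (h : Torus.IsClassicalNSSolutionOn (Icc a b) ν f u p) (hab : a < b) {t : ℝ}
    (ht : t ∈ Icc a b) (i j : d) (x : UnitAddTorus d) :
    HasDerivWithinAt (fun s => Torus.partialDeriv i (u s) x j)
      (Torus.partialDeriv i (Torus.timeDerivWithin (Icc a b) u t) x j) (Icc a b) t := by
  have hU : UniqueDiffOn ℝ (Icc a b) := uniqueDiffOn_Icc hab
  have hu : Torus.IsSmoothSpaceTimeOn (Icc a b) u := h.smooth_velocity
  have hDi : Torus.IsSmoothSpaceTimeOn (Icc a b) (fun s => Torus.partialDeriv i (u s)) :=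
    hu.partialDeriv hU i
  have h1 := (hDi.apply j).hasDerivWithinAt_slice ht x
  rw [timeDerivWithin_apply_coord hDi hU ht x j, Torus.timeDerivWithin_partialDeriv_comm hab hu ht i x]
    at h1
  exact h1

/-- **The velocity-gradient transport identity** (Majda–Bertozzi 2002, §1.4 (1.29):
`DV/Dt + V² = −P + νΔV`, `V = ∇u`, `P` the pressure Hessian; here with forcing and componentwise).
Along a classical solution of `∂ₜu + (u·∇)u = νΔu − ∇p + f`, `div u = 0` on `T^d × [a, b]`
(`a < b`), for every `t ∈ [a, b]`, every point `x` and all indices `i, j`: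
`∂ₜ(∂ᵢu)ⱼ = ν (∂ᵢΔu)ⱼ − ∂ᵢ∂ⱼp + (∂ᵢf)ⱼ − ∑ₖ (∂ᵢu)ₖ(∂ₖu)ⱼ − ∑ₖ uₖ ∂ₖ(∂ᵢu)ⱼ`
(one-sided time derivative within `[a, b]`). [cite: MajdaBertozziCUP2002, §1.4 eq. (1.29)] -/
theorem timeDerivWithin_partialDeriv_apply
    {a b ν : ℝ} {f u : ℝ → UnitAddTorus d → EuclideanSpace ℝ d} {p : ℝ → UnitAddTorus d → ℝ}
    (h : Torus.IsClassicalNSSolutionOn (Icc a b) ν f u p) (hab : a < b) {t : ℝ}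
    (ht : t ∈ Icc a b) (i j : d) (x : UnitAddTorus d) :
    Torus.timeDerivWithin (Icc a b) (fun s y => Torus.partialDeriv i (u s) y j) t x =
      ν * Torus.partialDeriv i (Torus.laplacian (u t)) x j -
        Torus.partialDeriv i (Torus.partialDeriv j (p t)) x +
        Torus.partialDeriv i (f t) x j -
        (∑ k, Torus.partialDeriv i (u t) x k * Torus.partialDeriv k (u t) x j) -
        ∑ k, u t x k * Torus.partialDeriv k (Torus.partialDeriv i (u t)) x j := by
  set S : Set ℝ := Icc a b with hSdef
  have hU : UniqueDiffOn ℝ S := uniqueDiffOn_Icc hab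
  have hu : Torus.IsSmoothSpaceTimeOn S u := h.smooth_velocity
  have hut : Torus.IsSmooth (u t) := hu.isSmooth_slice ht
  have hpt : Torus.IsSmooth (p t) := h.smooth_pressure.isSmooth_slice ht
  set A : UnitAddTorus d → EuclideanSpace ℝ d := Torus.timeDerivWithin S u t with hAdef
  have hA : Torus.IsSmooth A := hu.isSmooth_timeDerivWithin hU ht
  have hΔ : Torus.IsSmooth (Torus.laplacian (u t)) := hut.laplacian
  have hC : Torus.IsSmooth (Torus.convect (u t) (u t)) := hut.convect hut
  have hG : Torus.IsSmooth (Torus.gradient (p t)) := hpt.gradient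
  -- the forcing slice is smooth (momentum equation)
  have hf : Torus.IsSmooth (f t) := by
    have hfun : f t = fun y => A y + Torus.convect (u t) (u t) y - ν • Torus.laplacian (u t) y +
        Torus.gradient (p t) y := by
      funext y
      have := h.momentum t ht y
      rw [hAdef, this]
      abel
    rw [hfun]
    exact ((hA.add hC).sub (hΔ.smul ν)).add hG
  -- Step 1: `∂ₜ(∂ᵢu)ⱼ = (∂ᵢA)ⱼ`
  rw [Torus.timeDerivWithin, (hasDerivWithinAt_partialDeriv_apply h hab ht i j x).derivWithin (hU t ht)]
  -- Step 2: `∂ᵢ A` from the momentum equation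
  have hAfun : A = ν • Torus.laplacian (u t) + ((fun y => -Torus.gradient (p t) y) +
      (f t + fun y => -Torus.convect (u t) (u t) y)) := by
    funext y
    have := h.momentum t ht y
    simp only [Pi.add_apply, Pi.smul_apply]
    rw [hAdef, eq_sub_of_add_eq this]
    abel
  have c1 : Torus.IsContDiff 1 (ν • Torus.laplacian (u t)) := (hΔ.smul ν).isContDiff (by simp)
  have c2 : Torus.IsContDiff 1 (fun y => -Torus.gradient (p t) y) := hG.neg.isContDiff (by simp)
  have c3 : Torus.IsContDiff 1 (f t) := hf.isContDiff (by simp)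
  have c4 : Torus.IsContDiff 1 (fun y => -Torus.convect (u t) (u t) y) :=
    hC.neg.isContDiff (by simp)
  have hDA : Torus.partialDeriv i A x = ν • Torus.partialDeriv i (Torus.laplacian (u t)) x -
      Torus.partialDeriv i (Torus.gradient (p t)) x + Torus.partialDeriv i (f t) x -
      Torus.partialDeriv i (Torus.convect (u t) (u t)) x := by
    show Torus.partialDeriv i (Torus.timeDerivWithin S u t) x = _
    rw [← hAdef, hAfun, Torus.partialDeriv_add c1 (c2.add (c3.add c4)) i,
      Torus.partialDeriv_add c2 (c3.add c4) i, Torus.partialDeriv_add c3 c4 i]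
    simp only [Pi.add_apply]
    rw [Torus.partialDeriv_const_smul (hΔ.isContDiff (by simp)) ν i, Pi.smul_apply,
      Torus.partialDeriv_neg, Torus.partialDeriv_neg]
    abel
  -- coordinates of the pieces
  have hgrad : Torus.partialDeriv i (Torus.gradient (p t)) x j =
      Torus.partialDeriv i (Torus.partialDeriv j (p t)) x := by
    rw [← Torus.partialDeriv_apply_coord (hG.isContDiff (by simp)) i x j]
    congr 1
    funext y
    exact gradient_apply_eq_partialDeriv (hpt.isContDiff (by simp)) y j
  have hconv : Torus.partialDeriv i (Torus.convect (u t) (u t)) x j =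
      (∑ k, u t x k * Torus.partialDeriv k (Torus.partialDeriv i (u t)) x j) +
        ∑ k, Torus.partialDeriv i (u t) x k * Torus.partialDeriv k (u t) x j := by
    rw [Torus.partialDeriv_convect_self hut i x]
    simp only [WithLp.ofLp_sum, WithLp.ofLp_add, WithLp.ofLp_smul, Finset.sum_apply, Pi.add_apply,
      Pi.smul_apply, smul_eq_mul, Finset.sum_add_distrib]
    congr 1
    refine Finset.sum_congr rfl fun k _ => ?_
    rw [Torus.partialDeriv_comm hut i k x]
  have hAx : Torus.partialDeriv i (Torus.timeDerivWithin (Icc a b) u t) x = Torus.partialDeriv i A x :=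
    rfl
  rw [hAx, hDA]
  simp only [WithLp.ofLp_sub, WithLp.ofLp_add, WithLp.ofLp_smul, Pi.sub_apply, Pi.add_apply,
    Pi.smul_apply, smul_eq_mul, hconv, hgrad]
  ring

end GradientTensor

end Summit.NavierStokesRegularity.FunctionalMining
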